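import Summits.NavierStokesRegularity.NavierStokesRegularity.Theorems.ExtremiserTransienceBangBangCoreDefs
import Summits.NavierStokesRegularity.NavierStokesRegularity.Theorems.ExtremiserTransienceKStarAttainedPerturbation
import Literature.Analysis.FluidPDE.ChaeTypeIIProfileEndpoint
import Literature.Analysis.FluidPDE.BKMClassGradientContinuity
import Literature.Analysis.FluidPDE.WholeSpaceIBP
import HarnessLib

/-!
# Route `ExtremiserTransience`, crux `RegularisedNearPlateauStability` (stmt-NavierStokesRegularity-28317),
# LINE g8-α «sparse bang-bang»: SPARSE FIELDS HAVE BOUNDEDLY MANY SEPARATED TOP POINTS (Sobolev count)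

`--supports stmt-NavierStokesRegularity-28317` (helper). Author: prover seat `ns-net-p2` (g2).

The analytic half of step P1 (`SparseTopCovering`) of `Cruxes/NearExtremalTransiencePerFlow/Lines/sparse_bangbang.lean`:
for an admissible field with the Lipschitz budget `‖Dv‖ ≤ A₁·M/λ` (`λ = √(Z/W)`) in the SPARSE class `W·λ ≤ N₀·M²`,
every finite `λ`-separated subset of the half-top set `{‖v‖ ≥ M/2}` has at most `m₀(A₁, N₀)` points
(`card_separated_halfTop_le`).  Mechanism: each such point carries the ball `B(x, λ/(4A₁)) ⊆ {‖v‖ ≥ M/4}` (mean value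
inequality), these balls are disjoint, and the Sobolev inequality `‖v‖₆ ≤ K·‖∇v‖₂` (tree:
`eLpNorm_six_le_lintegral_frobeniusNormSq_weakGradient'` with the classical gradient as weak gradient,
`hasWeakGradient_fderiv_of_contDiff`) together with `‖∇v‖₂² = ‖curl v‖₂² = Z` (tree:
`lintegral_frobeniusNormSq_fderiv_eq_lintegral_curl_sq`) prices each ball at `≍ λ³M⁶/A₁³` out of the total
`K⁶Z³ = K⁶λ⁶W³`; sparseness `λW ≤ N₀M²` makes the count `≤ C·K⁶·A₁³·N₀³`.
HONEST FRAMING: a counting lemma for one class of vector fields; nothing about Navier–Stokes is proved; no summit is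
proved by a line. [folklore]
-/

noncomputable section

open MeasureTheory Set Metric Filter Module
open scoped InnerProductSpace RealInnerProductSpace ENNReal NNReal ContDiff
open Literature.Analysis.FluidPDE
open Summit.NavierStokesRegularity.NavierStokesRegularity.Theorems.DepletionLadder.KStar.HalfSpace

namespace Summit.NavierStokesRegularity.NavierStokesRegularity.Theorems

-- the problem directory repeats the summit name (`NavierStokesRegularity/NavierStokesRegularity`)
set_option linter.dupNamespace false

namespace DepletionLadder.KStar.BangBang

variable {v : E3 → E3}

/-- **Sobolev in the admissible class**: `∫⁻ ‖v‖ₑ⁶ ≤ K⁶ · Z³` with `K` the tree's Gagliardo–Nirenberg–Sobolev constant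
(`n = 3`, `p = 2`), for an admissible field (`‖∇v‖₂ = ‖curl v‖₂`). [folklore] -/
theorem lintegral_enorm_rpow_six_le {M B : ℝ} (hadm : IsAdm v M B) :
    ∫⁻ x, ‖v x‖ₑ ^ (6 : ℝ) ≤
      (SNormLESNormFDerivOfEqConst E3 (volume : Measure E3) 2 : ℝ≥0∞) ^ (6 : ℝ) * ENNReal.ofReal (Zen v) ^ (3 : ℝ) := by
  obtain ⟨hv, hdiv, -, -, h0, h1, h2⟩ := hadm
  have hv1 : ContDiff ℝ 1 v := hv.of_le (by norm_cast)
  have hv2 : ContDiff ℝ 2 v := hv.of_le (by norm_cast)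
  have h0' : ∫⁻ x, ‖v x‖ₑ ^ 2 < ⊤ := by
    have : (fun x => ‖v x‖ₑ ^ 2) = fun x => ‖iteratedFDeriv ℝ 0 v x‖ₑ ^ 2 := by
      funext x; rw [← ofReal_norm, ← ofReal_norm, norm_iteratedFDeriv_zero]
    rw [this]; exact h0
  have hL2 : eLpNorm v 2 volume < ⊤ := lintegral_enorm_sq_lt_top_iff_eLpNorm.1 h0'
  have hW : HasWeakGradient v (fderiv ℝ v) := hasWeakGradient_fderiv_of_contDiff hv1
  have hS := eLpNorm_six_le_lintegral_frobeniusNormSq_weakGradient' (finrank_euclideanSpace_fin (𝕜 := ℝ) (n := 3))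
    hW (q := 2) le_rfl (by norm_num) hL2
  rw [lintegral_frobeniusNormSq_fderiv_eq_lintegral_curl_sq hv2 hdiv h0' h1 h2] at hS
  -- `∫⁻‖curl v‖ₑ² = ofReal Z`
  have hωc : Continuous (curl v) := continuous_curl hv1
  have hZi : Integrable (fun y => ‖curl v y‖ ^ 2) :=
    integrable_sq_norm_of_lintegral_lt_top hωc (lintegral_enorm_curl_sq_lt_top hv h1)
  have hZl : ∫⁻ x, ‖curl v x‖ₑ ^ 2 = ENNReal.ofReal (Zen v) := by
    simp only [Zen]
    rw [ofReal_integral_eq_lintegral_ofReal hZi (Eventually.of_forall fun x => sq_nonneg _)]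
    refine lintegral_congr fun x => ?_
    rw [← ofReal_norm, ENNReal.ofReal_pow (norm_nonneg _)]
  rw [hZl] at hS
  -- `∫⁻‖v‖ₑ⁶ = (eLpNorm v 6)⁶`
  have h6 : ∫⁻ x, ‖v x‖ₑ ^ (6 : ℝ) = (eLpNorm v 6 volume) ^ (6 : ℝ) := by
    rw [eLpNorm_eq_lintegral_rpow_enorm_toReal (by norm_num) (by norm_num), ENNReal.toReal_ofNat, ← ENNReal.rpow_mul]
    norm_num
  rw [h6]
  calc (eLpNorm v 6 volume) ^ (6 : ℝ)
      ≤ ((SNormLESNormFDerivOfEqConst E3 (volume : Measure E3) 2 : ℝ≥0∞) * ENNReal.ofReal (Zen v) ^ (1 / 2 : ℝ)) ^ (6 : ℝ) :=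
        ENNReal.rpow_le_rpow hS (by norm_num)
    _ = (SNormLESNormFDerivOfEqConst E3 (volume : Measure E3) 2 : ℝ≥0∞) ^ (6 : ℝ) * ENNReal.ofReal (Zen v) ^ (3 : ℝ) := by
        rw [ENNReal.mul_rpow_of_nonneg _ _ (by norm_num), ← ENNReal.rpow_mul]; norm_num

/-- The ball `B(x, r)` around a point with `‖v x‖ ≥ M/2` carries `‖v‖ ≥ M/2 − L·r` when `‖Dv‖ ≤ L`. [folklore] -/
theorem norm_ge_on_ball {M L r : ℝ} (hv : ContDiff ℝ ∞ v) (hL : ∀ x, ‖fderiv ℝ v x‖ ≤ L) {x y : E3}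
    (hx : M / 2 ≤ ‖v x‖) (hy : y ∈ ball x r) : M / 2 - L * r ≤ ‖v y‖ := by
  have hL0 : 0 ≤ L := (norm_nonneg _).trans (hL x)
  have hmv : ‖v y - v x‖ ≤ L * ‖y - x‖ :=
    (convex_univ).norm_image_sub_le_of_norm_fderiv_le (fun z _ => (hv.differentiable (by simp)) z)
      (fun z _ => hL z) (mem_univ x) (mem_univ y)
  have hyx : ‖y - x‖ ≤ r := by rw [← dist_eq_norm]; exact (mem_ball.1 hy).le
  have h1 : ‖v x‖ ≤ ‖v y‖ + ‖v y - v x‖ := by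
    calc ‖v x‖ = ‖v y - (v y - v x)‖ := by rw [sub_sub_cancel]
      _ ≤ ‖v y‖ + ‖v y - v x‖ := norm_sub_le _ _
  nlinarith [mul_le_mul_of_nonneg_left hyx hL0]

/-- **Sparse fields have boundedly many separated top points.** For budgets `A₁ ≥ 1`, `N₀ > 0` there is `m₀` such
that for every admissible field with `‖D¹v‖ ≤ A₁·M/λ` in the sparse class `W·λ ≤ N₀·M²` (non-degenerate; any real `N₀`),
every finite `λ`-separated subset of `{‖v‖ ≥ M/2}` has at most `m₀` points. [folklore] -/
theorem card_separated_halfTop_le {A₁ N₀ : ℝ} (hA₁ : 1 ≤ A₁) :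
    ∃ m₀ : ℕ, ∀ (v : E3 → E3) (M B : ℝ), IsAdm v M B →
      (∀ x, ‖iteratedFDeriv ℝ 1 v x‖ ≤ A₁ * M * (lam v)⁻¹) → Wpa v * lam v ≤ N₀ * M ^ 2 →
      0 < M * Real.sqrt (Zen v) * Real.sqrt (Wpa v) →
      ∀ P : Finset E3, (↑P : Set E3) ⊆ {x | M / 2 ≤ ‖v x‖} →
        (∀ p ∈ P, ∀ q ∈ P, p ≠ q → lam v ≤ dist p q) → P.card ≤ m₀ := by
  -- constants
  set K : ℝ := ((SNormLESNormFDerivOfEqConst E3 (volume : Measure E3) 2 : ℝ≥0) : ℝ) with hKdef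
  set V : ℝ := ((volume : Measure E3) (ball (0 : E3) 1)).toReal with hVdef
  have hK0 : 0 ≤ K := NNReal.coe_nonneg _
  have hVpos : 0 < V := ENNReal.toReal_pos (measure_ball_pos volume (0 : E3) one_pos).ne' measure_ball_lt_top.ne
  set R : ℝ := 4 ^ 6 * 64 * K ^ 6 * A₁ ^ 3 * N₀ ^ 3 / V with hRdef
  refine ⟨⌈R⌉₊, ?_⟩
  intro v M B hadm hD1 hsp hpos P hPT hsep
  classical
  obtain ⟨hv, hdiv, hM, hB, h0, h1, h2⟩ := hadm
  -- non-degeneracy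
  have hZ0 : 0 ≤ Zen v := integral_nonneg fun x => by positivity
  have hW0 : 0 ≤ Wpa v := integral_nonneg fun x => frobeniusNormSq_nonneg _
  have hMpos : 0 < M := by
    by_contra h
    exact absurd hpos (not_lt.2 (mul_nonpos_of_nonpos_of_nonneg
      (mul_nonpos_of_nonpos_of_nonneg (not_lt.1 h) (Real.sqrt_nonneg _)) (Real.sqrt_nonneg _)))
  have hsZpos : 0 < Real.sqrt (Zen v) :=
    lt_of_le_of_ne (Real.sqrt_nonneg _) fun h => by rw [← h] at hpos; simp at hpos
  have hsWpos : 0 < Real.sqrt (Wpa v) :=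
    lt_of_le_of_ne (Real.sqrt_nonneg _) fun h => by rw [← h] at hpos; simp at hpos
  have hZpos : 0 < Zen v := Real.sqrt_pos.1 hsZpos
  have hWpos : 0 < Wpa v := Real.sqrt_pos.1 hsWpos
  have hlampos : 0 < lam v := Real.sqrt_pos.2 (div_pos hZpos hWpos)
  have hZeq : Zen v = lam v ^ 2 * Wpa v := by
    have h := Real.sq_sqrt (div_nonneg hZ0 hW0)
    rw [show Real.sqrt (Zen v / Wpa v) = lam v from rfl] at h
    rw [h, div_mul_cancel₀ _ hWpos.ne']
  -- the Lipschitz bound and the radius `r = λ/(4A₁)`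
  have hA0 : 0 < A₁ := lt_of_lt_of_le one_pos hA₁
  have hL : ∀ x, ‖fderiv ℝ v x‖ ≤ A₁ * M * (lam v)⁻¹ := fun x => by
    rw [← norm_iteratedFDeriv_one (𝕜 := ℝ) (f := v)]; exact hD1 x
  set r : ℝ := lam v / (4 * A₁) with hrdef
  have hrpos : 0 < r := by rw [hrdef]; positivity
  have hLr : A₁ * M * (lam v)⁻¹ * r = M / 4 := by rw [hrdef]; field_simp
  -- on each ball `B(p, r)`, `‖v‖ ≥ M/4`
  have hball : ∀ p ∈ P, ∀ y ∈ ball p r, M / 4 ≤ ‖v y‖ := by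
    intro p hp y hy
    have h := norm_ge_on_ball hv hL (hPT hp) hy
    rw [hLr] at h; linarith
  -- the balls are pairwise disjoint (`2r ≤ λ ≤ dist`)
  have hdisj : Set.PairwiseDisjoint (↑P : Set E3) (fun p => ball p r) := by
    intro p hp q hq hpq
    refine Set.disjoint_left.2 fun y hyp hyq => ?_
    have hd := hsep p hp q hq hpq
    rw [mem_ball] at hyp hyq
    have htri := dist_triangle p y q
    rw [dist_comm p y] at htri
    have h2r : 2 * r ≤ lam v := by
      rw [hrdef]
      have : lam v / (4 * A₁) ≤ lam v / 4 := div_le_div_of_nonneg_left hlampos.le (by norm_num) (by nlinarith)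
      linarith
    linarith
  -- lower bound: `card P · (M/4)⁶ · vol B_r ≤ ∫⁻‖v‖ₑ⁶`
  have hvol : ∀ p : E3, volume (ball p r) = ENNReal.ofReal (r ^ 3) * volume (ball (0 : E3) 1) := fun p => by
    rw [Measure.addHaar_ball volume p hrpos.le, finrank_euclideanSpace_fin]
  have hlow : (P.card : ℝ≥0∞) * (ENNReal.ofReal (M / 4) ^ (6 : ℝ) * (ENNReal.ofReal (r ^ 3) * volume (ball (0 : E3) 1)))
      ≤ ∫⁻ x, ‖v x‖ₑ ^ (6 : ℝ) := by
    calc (P.card : ℝ≥0∞) * (ENNReal.ofReal (M / 4) ^ (6 : ℝ) * (ENNReal.ofReal (r ^ 3) * volume (ball (0 : E3) 1)))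
        = ∑ p ∈ P, ENNReal.ofReal (M / 4) ^ (6 : ℝ) * volume (ball p r) := by
          rw [Finset.sum_congr rfl fun p _ => by rw [hvol p], Finset.sum_const, nsmul_eq_mul]
      _ = ∑ p ∈ P, ∫⁻ x in ball p r, ENNReal.ofReal (M / 4) ^ (6 : ℝ) := by
          refine Finset.sum_congr rfl fun p _ => ?_
          rw [setLIntegral_const]
      _ ≤ ∑ p ∈ P, ∫⁻ x in ball p r, ‖v x‖ₑ ^ (6 : ℝ) := by
          refine Finset.sum_le_sum fun p hp => setLIntegral_mono' measurableSet_ball fun y hy => ?_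
          refine ENNReal.rpow_le_rpow ?_ (by norm_num)
          rw [← ofReal_norm]
          exact ENNReal.ofReal_le_ofReal (hball p hp y hy)
      _ = ∫⁻ x in ⋃ p ∈ P, ball p r, ‖v x‖ₑ ^ (6 : ℝ) :=
          (lintegral_biUnion_finset hdisj (fun p _ => measurableSet_ball) _).symm
      _ ≤ ∫⁻ x, ‖v x‖ₑ ^ (6 : ℝ) := setLIntegral_le_lintegral _ _
  have hup := lintegral_enorm_rpow_six_le (⟨hv, hdiv, hM, hB, h0, h1, h2⟩ : IsAdm v M B)
  have hchain := hlow.trans hup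
  -- pass to real numbers
  have hfin : (SNormLESNormFDerivOfEqConst E3 (volume : Measure E3) 2 : ℝ≥0∞) ^ (6 : ℝ) * ENNReal.ofReal (Zen v) ^ (3 : ℝ) ≠ ⊤ :=
    ENNReal.mul_ne_top (ENNReal.rpow_ne_top_of_nonneg (by norm_num) ENNReal.coe_ne_top)
      (ENNReal.rpow_ne_top_of_nonneg (by norm_num) ENNReal.ofReal_ne_top)
  have hreal := (ENNReal.toReal_le_toReal (ne_top_of_le_ne_top hfin hchain) hfin).2 hchain
  have e6 : (6 : ℝ) = ((6 : ℕ) : ℝ) := by norm_num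
  have e3 : (3 : ℝ) = ((3 : ℕ) : ℝ) := by norm_num
  rw [e6, e3] at hreal
  simp only [ENNReal.rpow_natCast, ENNReal.toReal_mul, ENNReal.toReal_natCast, ENNReal.toReal_pow,
    ENNReal.toReal_ofReal (div_pos hMpos four_pos).le, ENNReal.toReal_ofReal (pow_pos hrpos 3).le,
    ENNReal.toReal_ofReal hZ0, ENNReal.coe_toReal] at hreal
  -- `hreal : card · ((M/4)^6 · (r³ · V)) ≤ K^6 · Z^3`
  have hR : (P.card : ℝ) ≤ R := by
    have hden : 0 < (M / 4) ^ 6 * (r ^ 3 * V) := by positivity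
    have h1' : (P.card : ℝ) ≤ K ^ 6 * Zen v ^ 3 / ((M / 4) ^ 6 * (r ^ 3 * V)) := by
      rw [le_div_iff₀ hden]; exact hreal
    refine h1'.trans ?_
    -- `K⁶ Z³ / ((M/4)⁶ r³ V) = 4⁶·64·K⁶·A₁³·(λW/M²)³ / V ≤ R`
    have hN : Wpa v * lam v / M ^ 2 ≤ N₀ := by
      rw [div_le_iff₀ (pow_pos hMpos 2)]; exact hsp
    have hN0 : 0 ≤ Wpa v * lam v / M ^ 2 := by positivity
    have hcube : (Wpa v * lam v / M ^ 2) ^ 3 ≤ N₀ ^ 3 := pow_le_pow_left₀ hN0 hN 3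
    have hexpr : K ^ 6 * Zen v ^ 3 / ((M / 4) ^ 6 * (r ^ 3 * V)) =
        4 ^ 6 * 64 * K ^ 6 * A₁ ^ 3 * (Wpa v * lam v / M ^ 2) ^ 3 / V := by
      rw [hZeq, hrdef]
      field_simp
      ring
    rw [hexpr, hRdef]
    have hc : 0 ≤ 4 ^ 6 * 64 * K ^ 6 * A₁ ^ 3 := by positivity
    exact div_le_div_of_nonneg_right (mul_le_mul_of_nonneg_left hcube hc) hVpos.le
  exact_mod_cast hR.trans (Nat.le_ceil R)

end DepletionLadder.KStar.BangBang

end Summit.NavierStokesRegularity.NavierStokesRegularity.Theorems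

end
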